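import Summits.CriticalPhenomena.PercolationContinuityZ3.Theorems.PercNearOneGluingNoHeavyLowerTailAntitheticTwinTop
import HarnessLib

/-!
# `NoHeavyLowerTail` (stmt-CriticalPhenomena-4575) — antithetic cluster pairs: **TWINS OVER A NON-EDGE {a, j} WITH j OF DEGREE 3 — cluster
# identities for the PAIRING PRINCIPLE** (prim-hp-2 gen 73, HOME/THEOREM-TW.md §3ter)

Support file (`--supports stmt-CriticalPhenomena-4575`, hull-port prover `prim-hp-2`, gen 73).  No definitions, no named facts, no sorries;
standard axioms.  Setting (THEOREM TP, smallest case): `N(s) = N(P) = {a, j}`, `a ≠ j`, `N(j) = {s, P, j₀}` (so `a ≁ j` and `j` has exactly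
one neighbour `j₀` in `H = G − s − P`); everything else arbitrary.  `E'` = the pairs of `E` avoiding `s, P, j` (the graph `H − j`),
`X' T = openCluster (T ∩ E') a`, `Y' T = openCluster (Tᶜ ∩ E') a`.  On the part of the top event `{P ∈ X T, P ∉ Y T}` without red–red common
neighbour the types of `(a, j)` are (RB, BR) — PATTERN 1: `sa, Pj, jj₀` red, `sj, Pa` blue — or (BR, RB) — PATTERN 2: `sj, Pa, jj₀` red,
`sa, Pj` blue —, in both cases `j₀ ∈ X' T`, and
  pattern 1:  `X T = {s, P, j} ∪ X' T`,  `Y T = {s, j}`;      pattern 2:  `X T = {s, P, j} ∪ X' T`,  `Y T = {s} ∪ Y' T`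
(`TwinPair.red_eq₁ / blue_eq₁ / red_eq₂ / blue_eq₂`; converses `link_of_top₁ / link_of_top₂`; exclusions `not_top_RB_RB / not_top_BR_BR`).
The sums are assembled in …AntitheticTwinPair.
[cite: VandenbergHaggstromKahn2005, §1 p. 3 (open cluster `C_s`)]
-/

noncomputable section

namespace Summit.CriticalPhenomena.PercolationContinuityZ3.Theorems

open Literature.Probability.Percolation
open scoped Classical

namespace Antithetic

namespace TwinPair

variable {V : Type*} {E E' : Set (Sym2 V)} {s P a j j₀ : V}

/-- Transitivity of cluster membership. [folklore] -/
theorem reach_trans {ω : Set (Sym2 V)} {x y z : V} (hxy : y ∈ openCluster ω x) (hyz : z ∈ openCluster ω y) : z ∈ openCluster ω x :=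
  SimpleGraph.Reachable.trans hxy hyz

/-- The `E'`-cluster of a vertex `b ∉ {s, P, j}` (any colour set `ω`) avoids `s`, `P` and `j`. [this work] -/
theorem cluster_E'_avoids (hE' : E' = {e | e ∈ E ∧ s ∉ e ∧ P ∉ e ∧ j ∉ e}) {ω : Set (Sym2 V)} {b : V}
    (hbs : b ≠ s) (hbP : b ≠ P) (hbj : b ≠ j) {u : V} (hu : u ∈ openCluster (ω ∩ E') b) : u ≠ s ∧ u ≠ P ∧ u ≠ j := by
  have hsub : openCluster (ω ∩ E') b ⊆ {u : V | u ≠ s ∧ u ≠ P ∧ u ≠ j} := by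
    refine TwoStage.Fan.cluster_subset_of_closed (S := {u : V | u ≠ s ∧ u ≠ P ∧ u ≠ j})
      (by simp only [Set.mem_setOf_eq]; exact ⟨hbs, hbP, hbj⟩) fun u w _ huw => ?_
    obtain ⟨⟨-, hwE⟩, -⟩ := (openGraph_adj _ u w).1 huw
    rw [hE'] at hwE
    obtain ⟨-, h1, h2, h3⟩ := hwE
    exact ⟨fun h => h1 (h ▸ Sym2.mem_mk_right u w), fun h => h2 (h ▸ Sym2.mem_mk_right u w), fun h => h3 (h ▸ Sym2.mem_mk_right u w)⟩
  exact hsub hu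

/-- `E'`-clusters are sub-clusters of `E`-clusters. [this work] -/
theorem cluster_E'_subset (hE' : E' = {e | e ∈ E ∧ s ∉ e ∧ P ∉ e ∧ j ∉ e}) (ω : Set (Sym2 V)) (b : V) :
    openCluster (ω ∩ E') b ⊆ openCluster (ω ∩ E) b := by
  refine Freeze.openCluster_mono (fun e he => ?_) b
  have h : e ∈ E' := he.2
  rw [hE'] at h
  exact ⟨he.1, h.1⟩

/-- A pair of `E` avoiding `s, P, j` is a pair of `E'`. [this work] -/
theorem mem_E' (hE' : E' = {e | e ∈ E ∧ s ∉ e ∧ P ∉ e ∧ j ∉ e}) {u w : V} (huw : s(u, w) ∈ E) (hus : u ≠ s) (huP : u ≠ P) (huj : u ≠ j)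
    (hws : w ≠ s) (hwP : w ≠ P) (hwj : w ≠ j) : s(u, w) ∈ E' := by
  rw [hE']
  refine ⟨huw, ?_, ?_, ?_⟩
  · rw [Sym2.mem_iff]; rintro (h | h)
    · exact hus h.symm
    · exact hws h.symm
  · rw [Sym2.mem_iff]; rintro (h | h)
    · exact huP h.symm
    · exact hwP h.symm
  · rw [Sym2.mem_iff]; rintro (h | h)
    · exact huj h.symm
    · exact hwj h.symm

/-- A step along a pair of `ω ∩ E` from a vertex of the `E'`-cluster of `a` leads to `s`, `P`, `j` or stays in the cluster. [this work] -/
theorem step_from_cluster (hE' : E' = {e | e ∈ E ∧ s ∉ e ∧ P ∉ e ∧ j ∉ e}) (has : a ≠ s) (haP : a ≠ P) (haj : a ≠ j)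
    {ω : Set (Sym2 V)} {u w : V} (hu : u ∈ openCluster (ω ∩ E') a) (hω : s(u, w) ∈ ω) (hE : s(u, w) ∈ E) (hne : u ≠ w) :
    w = s ∨ w = P ∨ w = j ∨ w ∈ openCluster (ω ∩ E') a := by
  by_cases hws : w = s
  · exact Or.inl hws
  by_cases hwP : w = P
  · exact Or.inr (Or.inl hwP)
  by_cases hwj : w = j
  · exact Or.inr (Or.inr (Or.inl hwj))
  obtain ⟨hus, huP, huj⟩ := cluster_E'_avoids hE' has haP haj hu
  exact Or.inr (Or.inr (Or.inr (TwoStage.Cone.mem_cluster_of_adj hu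
    ((openGraph_adj _ u w).2 ⟨⟨hω, mem_E' hE' hE hus huP huj hws hwP hwj⟩, hne⟩))))

/-- **Pattern 2, red cluster.**  `sj, Pa, jj₀` red, `sa` blue, `j₀ ∈ X' T`  ⇒  `X T = {s, P, j} ∪ X' T`. [this work] -/
theorem red_eq₂ (hE' : E' = {e | e ∈ E ∧ s ∉ e ∧ P ∉ e ∧ j ∉ e}) (hsa : s ≠ a) (hsj : s ≠ j) (hPa : P ≠ a) (haj : a ≠ j) (hj₀j : j₀ ≠ j)
    (hNs : ∀ v, s(s, v) ∈ E ↔ (v = a ∨ v = j)) (hNP : ∀ v, s(P, v) ∈ E ↔ (v = a ∨ v = j))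
    (hNj : ∀ v, s(j, v) ∈ E ↔ (v = s ∨ v = P ∨ v = j₀))
    {T : Set (Sym2 V)} (h_sa : s(s, a) ∉ T) (h_Pa : s(P, a) ∈ T) (h_sj : s(s, j) ∈ T) (h_jj : s(j, j₀) ∈ T)
    (hU : j₀ ∈ openCluster (T ∩ E') a) :
    openCluster (T ∩ E) s = insert s (insert P (insert j (openCluster (T ∩ E') a))) := by
  apply Set.Subset.antisymm
  · refine TwoStage.Fan.cluster_subset_of_closed (Set.mem_insert s _) fun u w hu huw => ?_
    obtain ⟨⟨hT, hE⟩, hne⟩ := (openGraph_adj _ u w).1 huw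
    rcases hu with rfl | rfl | rfl | hu
    · rcases (hNs w).1 hE with rfl | rfl
      · exact absurd hT h_sa
      · exact Or.inr (Or.inr (Or.inl rfl))
    · rcases (hNP w).1 hE with rfl | rfl
      · exact Or.inr (Or.inr (Or.inr (mem_openCluster_self _ _)))
      · exact Or.inr (Or.inr (Or.inl rfl))
    · rcases (hNj w).1 hE with rfl | rfl | rfl
      · exact Or.inl rfl
      · exact Or.inr (Or.inl rfl)
      · exact Or.inr (Or.inr (Or.inr hU))
    · exact step_from_cluster hE' hsa.symm hPa.symm haj hu hT hE hne
  · have hj : j ∈ openCluster (T ∩ E) s := Twin.mem_red_of_pair (mem_openCluster_self _ s) h_sj ((hNs j).2 (Or.inr rfl)) hsj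
    have hj₀ : j₀ ∈ openCluster (T ∩ E) s := Twin.mem_red_of_pair hj h_jj ((hNj j₀).2 (Or.inr (Or.inr rfl))) hj₀j.symm
    have ha : a ∈ openCluster (T ∩ E) s :=
      reach_trans hj₀ (cluster_E'_subset hE' T j₀ (TwoStage.Cone.mem_cluster_comm.1 hU))
    have hP : P ∈ openCluster (T ∩ E) s :=
      Twin.mem_red_of_pair ha (by rw [Sym2.eq_swap]; exact h_Pa) (by rw [Sym2.eq_swap]; exact (hNP a).2 (Or.inl rfl)) hPa.symm
    rintro u (rfl | rfl | rfl | hu)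
    · exact mem_openCluster_self _ _
    · exact hP
    · exact hj
    · exact reach_trans ha (cluster_E'_subset hE' T a hu)

/-- **Pattern 2, blue cluster.**  `sa` blue, `Pa, sj, jj₀` red  ⇒  `Y T = {s} ∪ Y' T`. [this work] -/
theorem blue_eq₂ (hE' : E' = {e | e ∈ E ∧ s ∉ e ∧ P ∉ e ∧ j ∉ e}) (hsa : s ≠ a) (hPa : P ≠ a) (haj : a ≠ j)
    (hNs : ∀ v, s(s, v) ∈ E ↔ (v = a ∨ v = j)) (hNP : ∀ v, s(P, v) ∈ E ↔ (v = a ∨ v = j))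
    (hNj : ∀ v, s(j, v) ∈ E ↔ (v = s ∨ v = P ∨ v = j₀))
    {T : Set (Sym2 V)} (h_sa : s(s, a) ∉ T) (h_Pa : s(P, a) ∈ T) (h_sj : s(s, j) ∈ T) (h_jj : s(j, j₀) ∈ T) :
    openCluster (Tᶜ ∩ E) s = insert s (openCluster (Tᶜ ∩ E') a) := by
  apply Set.Subset.antisymm
  · refine TwoStage.Fan.cluster_subset_of_closed (Set.mem_insert s _) fun u w hu huw => ?_
    obtain ⟨⟨hT, hE⟩, hne⟩ := (openGraph_adj _ u w).1 huw
    rcases hu with rfl | hu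
    · rcases (hNs w).1 hE with rfl | rfl
      · exact Or.inr (mem_openCluster_self _ _)
      · exact absurd h_sj hT
    · rcases step_from_cluster hE' hsa.symm hPa.symm haj hu hT hE hne with rfl | rfl | rfl | hw
      · exact Or.inl rfl
      · obtain ⟨hus, huP, huj⟩ := cluster_E'_avoids hE' hsa.symm hPa.symm haj hu
        rcases (hNP u).1 (by rw [Sym2.eq_swap]; exact hE) with rfl | rfl
        · exact absurd (by rw [Sym2.eq_swap]; exact h_Pa) hT
        · exact absurd rfl huj
      · obtain ⟨hus, huP, huj⟩ := cluster_E'_avoids hE' hsa.symm hPa.symm haj hu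
        rcases (hNj u).1 (by rw [Sym2.eq_swap]; exact hE) with rfl | rfl | rfl
        · exact absurd rfl hus
        · exact absurd rfl huP
        · exact absurd (by rw [Sym2.eq_swap]; exact h_jj) hT
      · exact Or.inr hw
  · have ha : a ∈ openCluster (Tᶜ ∩ E) s := Twin.mem_blue_of_pair (mem_openCluster_self _ s) h_sa ((hNs a).2 (Or.inl rfl)) hsa
    rintro u (rfl | hu)
    · exact mem_openCluster_self _ _
    · exact reach_trans ha (cluster_E'_subset hE' Tᶜ a hu)

/-- **Pattern 1, red cluster.**  `sa, Pj, jj₀` red, `j₀ ∈ X' T`  ⇒  `X T = {s, P, j} ∪ X' T`. [this work] -/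
theorem red_eq₁ (hE' : E' = {e | e ∈ E ∧ s ∉ e ∧ P ∉ e ∧ j ∉ e}) (hsa : s ≠ a) (hPa : P ≠ a) (hPj : P ≠ j) (haj : a ≠ j) (hj₀j : j₀ ≠ j)
    (hNs : ∀ v, s(s, v) ∈ E ↔ (v = a ∨ v = j)) (hNP : ∀ v, s(P, v) ∈ E ↔ (v = a ∨ v = j))
    (hNj : ∀ v, s(j, v) ∈ E ↔ (v = s ∨ v = P ∨ v = j₀))
    {T : Set (Sym2 V)} (h_sa : s(s, a) ∈ T) (h_Pj : s(P, j) ∈ T) (h_jj : s(j, j₀) ∈ T) (hU : j₀ ∈ openCluster (T ∩ E') a) :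
    openCluster (T ∩ E) s = insert s (insert P (insert j (openCluster (T ∩ E') a))) := by
  apply Set.Subset.antisymm
  · refine TwoStage.Fan.cluster_subset_of_closed (Set.mem_insert s _) fun u w hu huw => ?_
    obtain ⟨⟨hT, hE⟩, hne⟩ := (openGraph_adj _ u w).1 huw
    rcases hu with rfl | rfl | rfl | hu
    · rcases (hNs w).1 hE with rfl | rfl
      · exact Or.inr (Or.inr (Or.inr (mem_openCluster_self _ _)))
      · exact Or.inr (Or.inr (Or.inl rfl))
    · rcases (hNP w).1 hE with rfl | rfl
      · exact Or.inr (Or.inr (Or.inr (mem_openCluster_self _ _)))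
      · exact Or.inr (Or.inr (Or.inl rfl))
    · rcases (hNj w).1 hE with rfl | rfl | rfl
      · exact Or.inl rfl
      · exact Or.inr (Or.inl rfl)
      · exact Or.inr (Or.inr (Or.inr hU))
    · exact step_from_cluster hE' hsa.symm hPa.symm haj hu hT hE hne
  · have ha : a ∈ openCluster (T ∩ E) s := Twin.mem_red_of_pair (mem_openCluster_self _ s) h_sa ((hNs a).2 (Or.inl rfl)) hsa
    have hj₀ : j₀ ∈ openCluster (T ∩ E) s := reach_trans ha (cluster_E'_subset hE' T a hU)
    have hj : j ∈ openCluster (T ∩ E) s :=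
      Twin.mem_red_of_pair hj₀ (by rw [Sym2.eq_swap]; exact h_jj) (by rw [Sym2.eq_swap]; exact (hNj j₀).2 (Or.inr (Or.inr rfl))) hj₀j
    have hP : P ∈ openCluster (T ∩ E) s :=
      Twin.mem_red_of_pair hj (by rw [Sym2.eq_swap]; exact h_Pj) ((hNj P).2 (Or.inr (Or.inl rfl))) hPj.symm
    rintro u (rfl | rfl | rfl | hu)
    · exact mem_openCluster_self _ _
    · exact hP
    · exact hj
    · exact reach_trans ha (cluster_E'_subset hE' T a hu)

/-- **Pattern 1, blue cluster.**  `sj` blue, `sa, Pj, jj₀` red  ⇒  `Y T = {s, j}`. [this work] -/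
theorem blue_eq₁ (hsj : s ≠ j) (hNs : ∀ v, s(s, v) ∈ E ↔ (v = a ∨ v = j)) (hNj : ∀ v, s(j, v) ∈ E ↔ (v = s ∨ v = P ∨ v = j₀))
    {T : Set (Sym2 V)} (h_sa : s(s, a) ∈ T) (h_sj : s(s, j) ∉ T) (h_Pj : s(P, j) ∈ T) (h_jj : s(j, j₀) ∈ T) :
    openCluster (Tᶜ ∩ E) s = insert s ({j} : Set V) := by
  apply Set.Subset.antisymm
  · refine TwoStage.Fan.cluster_subset_of_closed (Set.mem_insert s _) fun u w hu huw => ?_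
    obtain ⟨⟨hT, hE⟩, hne⟩ := (openGraph_adj _ u w).1 huw
    rcases hu with rfl | hu
    · rcases (hNs w).1 hE with rfl | rfl
      · exact absurd h_sa hT
      · exact Or.inr rfl
    · rw [Set.mem_singleton_iff] at hu
      subst hu
      rcases (hNj w).1 hE with rfl | rfl | rfl
      · exact Or.inl rfl
      · exact absurd (by rw [Sym2.eq_swap]; exact h_Pj) hT
      · exact absurd h_jj hT
  · rintro u (rfl | hu)
    · exact mem_openCluster_self _ _
    · rw [Set.mem_singleton_iff] at hu
      subst hu
      exact Twin.mem_blue_of_pair (mem_openCluster_self _ s) h_sj ((hNs u).2 (Or.inr rfl)) hsj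

/-- **Converse, pattern 2.**  `sa, Pj` blue and `P ∈ X T`  ⇒  `jj₀` red and `j₀ ∈ X' T`. [this work] -/
theorem link_of_top₂ (hE' : E' = {e | e ∈ E ∧ s ∉ e ∧ P ∉ e ∧ j ∉ e}) (hsP : s ≠ P) (hPa : P ≠ a) (hPj : P ≠ j) (haj : a ≠ j)
    (hj₀s : j₀ ≠ s) (hj₀P : j₀ ≠ P) (hj₀j : j₀ ≠ j)
    (hNs : ∀ v, s(s, v) ∈ E ↔ (v = a ∨ v = j)) (hNP : ∀ v, s(P, v) ∈ E ↔ (v = a ∨ v = j))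
    (hNj : ∀ v, s(j, v) ∈ E ↔ (v = s ∨ v = P ∨ v = j₀))
    {T : Set (Sym2 V)} (h_sa : s(s, a) ∉ T) (h_Pj : s(P, j) ∉ T) (hPX : P ∈ openCluster (T ∩ E) s) :
    s(j, j₀) ∈ T ∧ j₀ ∈ openCluster (T ∩ E') a := by
  by_contra h
  have hsub : openCluster (T ∩ E) s ⊆ {u | u = s ∨ u = j ∨ (s(j, j₀) ∈ T ∧ u ∈ openCluster (T ∩ E') j₀)} := by
    refine TwoStage.Fan.cluster_subset_of_closed (show s ∈ {u : V | _} from Or.inl rfl) fun u w hu huw => ?_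
    obtain ⟨⟨hT, hE⟩, hne⟩ := (openGraph_adj _ u w).1 huw
    rcases hu with rfl | rfl | ⟨hjj, hu⟩
    · rcases (hNs w).1 hE with rfl | rfl
      · exact absurd hT h_sa
      · exact Or.inr (Or.inl rfl)
    · rcases (hNj w).1 hE with rfl | rfl | rfl
      · exact Or.inl rfl
      · exact absurd (by rw [Sym2.eq_swap]; exact hT) h_Pj
      · exact Or.inr (Or.inr ⟨hT, mem_openCluster_self _ _⟩)
    · by_cases hws : w = s
      · exact Or.inl hws
      by_cases hwj : w = j
      · exact Or.inr (Or.inl hwj)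
      by_cases hwP : w = P
      · -- `u ~ P`: then `u ∈ {a, j}`; `u = a` puts `a` in the cluster of `j₀`: contradiction with `h`
        exfalso
        subst hwP
        obtain ⟨hus, huP, huj⟩ := cluster_E'_avoids hE' hj₀s hj₀P hj₀j hu
        rcases (hNP u).1 (by rw [Sym2.eq_swap]; exact hE) with rfl | rfl
        · exact h ⟨hjj, TwoStage.Cone.mem_cluster_comm.1 hu⟩
        · exact huj rfl
      · obtain ⟨hus, huP, huj⟩ := cluster_E'_avoids hE' hj₀s hj₀P hj₀j hu
        exact Or.inr (Or.inr ⟨hjj, TwoStage.Cone.mem_cluster_of_adj hu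
          ((openGraph_adj _ u w).2 ⟨⟨hT, mem_E' hE' hE hus huP huj hws hwP hwj⟩, hne⟩)⟩)
  rcases hsub hPX with h1 | h1 | ⟨-, h1⟩
  · exact hsP h1.symm
  · exact hPj h1
  · exact (cluster_E'_avoids hE' hj₀s hj₀P hj₀j h1).2.1 rfl

/-- **Converse, pattern 1.**  `Pa, sj` blue and `P ∈ X T`  ⇒  `jj₀` red and `j₀ ∈ X' T`. [this work] -/
theorem link_of_top₁ (hE' : E' = {e | e ∈ E ∧ s ∉ e ∧ P ∉ e ∧ j ∉ e}) (hsP : s ≠ P) (hsa : s ≠ a) (hPa : P ≠ a) (haj : a ≠ j)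
    (hNs : ∀ v, s(s, v) ∈ E ↔ (v = a ∨ v = j)) (hNP : ∀ v, s(P, v) ∈ E ↔ (v = a ∨ v = j))
    (hNj : ∀ v, s(j, v) ∈ E ↔ (v = s ∨ v = P ∨ v = j₀))
    {T : Set (Sym2 V)} (h_Pa : s(P, a) ∉ T) (h_sj : s(s, j) ∉ T) (hPX : P ∈ openCluster (T ∩ E) s) :
    s(j, j₀) ∈ T ∧ j₀ ∈ openCluster (T ∩ E') a := by
  by_contra h
  have hsub : openCluster (T ∩ E) s ⊆ insert s (openCluster (T ∩ E') a) := by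
    refine TwoStage.Fan.cluster_subset_of_closed (Set.mem_insert s _) fun u w hu huw => ?_
    obtain ⟨⟨hT, hE⟩, hne⟩ := (openGraph_adj _ u w).1 huw
    rcases hu with rfl | hu
    · rcases (hNs w).1 hE with rfl | rfl
      · exact Or.inr (mem_openCluster_self _ _)
      · exact absurd hT h_sj
    · rcases step_from_cluster hE' hsa.symm hPa.symm haj hu hT hE hne with rfl | rfl | rfl | hw
      · exact Or.inl rfl
      · exfalso
        obtain ⟨hus, huP, huj⟩ := cluster_E'_avoids hE' hsa.symm hPa.symm haj hu
        rcases (hNP u).1 (by rw [Sym2.eq_swap]; exact hE) with rfl | rfl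
        · exact h_Pa (by rw [Sym2.eq_swap]; exact hT)
        · exact huj rfl
      · exfalso
        obtain ⟨hus, huP, huj⟩ := cluster_E'_avoids hE' hsa.symm hPa.symm haj hu
        rcases (hNj u).1 (by rw [Sym2.eq_swap]; exact hE) with rfl | rfl | rfl
        · exact hus rfl
        · exact huP rfl
        · exact h ⟨by rw [Sym2.eq_swap]; exact hT, hu⟩
      · exact Or.inr hw
  rcases hsub hPX with h1 | h1
  · exact hsP h1.symm
  · exact (cluster_E'_avoids hE' hsa.symm hPa.symm haj h1).2.1 rfl

/-- **Exclusion (RB, RB).**  `Pa, Pj` blue ⇒ `P ∉ X T`. [this work] -/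
theorem not_top_RB_RB (hNP : ∀ v, s(P, v) ∈ E ↔ (v = a ∨ v = j)) {T : Set (Sym2 V)} (h_Pa : s(P, a) ∉ T) (h_Pj : s(P, j) ∉ T)
    (hsP : s ≠ P) : P ∉ openCluster (T ∩ E) s := by
  have hsub : openCluster (T ∩ E) s ⊆ {u | u ≠ P} := by
    refine TwoStage.Fan.cluster_subset_of_closed (show s ∈ {u : V | u ≠ P} from hsP) fun u w hu huw => ?_
    obtain ⟨⟨hT, hE⟩, hne⟩ := (openGraph_adj _ u w).1 huw
    intro hwP
    rw [hwP, Sym2.eq_swap] at hT hE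
    rcases (hNP u).1 hE with rfl | rfl
    · exact h_Pa hT
    · exact h_Pj hT
  exact fun hP => hsub hP rfl

/-- **Exclusion (BR, BR).**  `sa, sj` blue ⇒ `P ∉ X T`. [this work] -/
theorem not_top_BR_BR (hNs : ∀ v, s(s, v) ∈ E ↔ (v = a ∨ v = j)) {T : Set (Sym2 V)} (h_sa : s(s, a) ∉ T) (h_sj : s(s, j) ∉ T)
    (hsP : s ≠ P) : P ∉ openCluster (T ∩ E) s := by
  have hsub : openCluster (T ∩ E) s ⊆ {s} := by
    refine TwoStage.Fan.cluster_subset_of_closed (Set.mem_singleton s) fun u w hu huw => ?_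
    obtain ⟨⟨hT, hE⟩, hne⟩ := (openGraph_adj _ u w).1 huw
    rw [Set.mem_singleton_iff] at hu
    subst hu
    exfalso
    rcases (hNs w).1 hE with rfl | rfl
    · exact h_sa hT
    · exact h_sj hT
  exact fun hP => hsP (Set.mem_singleton_iff.1 (hsub hP)).symm

end TwinPair

end Antithetic

end Summit.CriticalPhenomena.PercolationContinuityZ3.Theorems
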